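import Summits.Ventures.LatticeQCDFlow.Scaling.AdjacentSchemeDiffusiveCeiling
import Summits.Ventures.LatticeQCDFlow.Scaling.ReplicaExchangeFrozenColdDirect
import Summits.Ventures.LatticeQCDFlow.Scaling.WeightedHubSchemeFloor

/-!
HONEST FRAMING: exact (Metropolis-corrected) sampling algorithms for lattice gauge theory; figures
of merit are autocorrelation/cost numbers at stated couplings and volumes; no continuum-physics
claim.

# WeightedLadderLaw — NO ALLOCATION OF THE UPDATES RESCUES THE ADJACENT LADDER: FOR EVERY PROBABILITY VECTOR `w` THE
# WEIGHTED LADDER `t·Sw + (1−t)·prodKernel w M` OVER SECTOR-FROZEN COLD REPLICAS HAS `Gap ≤ 3t/(v·K(K+1)(2K+1))` (EVERY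
# ADJACENT EXCHANGE MOVE), AND THE PLAIN WEIGHTED LADDER HAS
# `Gap ≥ min{p q^K t/(6K²(K+1)), p q^K γ₀(1−t)w_0/(6(K+1))}` — IDENTICAL LEVELS, HOT-ONLY UPDATES:
# `min{t/(6K²(K+1)), γ₀(1−t)/(6(K+1))} ≤ Gap ≤ 3t/(vK(K+1)(2K+1))`, `Θ(K³)` (lean-2 GEN-21, ours)

Venture-side (OURS).  Cell `lqcd-flow` (pub-lqcd), unit `pub-lqcd-lean-2-g21`, 2026-08-26.  Chapter I, fourteenth file.
`Scaling/WeightedHubSchemeFloor` (I1) showed that allocating the updates to the hot replica takes the HUB from order `K²`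
to the linear law.  This file shows that the same reallocation does NOTHING for the power of `K` on the adjacent LADDER:
the diffusive ceiling of `Scaling/AdjacentSchemeDiffusiveCeiling` (R14, stated there for uniform weights) holds for EVERY
probability vector `w` (the update term of the linear-count test function vanishes over frozen cold replicas whatever the
weights), and the direct conveyor floor of `Scaling/ReplicaExchangeFrozenColdDirect` (R6b) holds for the weighted ladder
with the hot relabel rate `(1−t)w_0` in place of `(1−t)/(K+1)` — so hot-only updates improve the hot term by a factor
`K+1` and leave the swap term `t/(6K²(K+1))`, order `K⁻³`, as the bottleneck: the labels DIFFUSE along the ladder.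

## What is proved

* §1 `weightedUpdate_dirichletForm_linearCount` (`𝓔(Upd_w; G) = Σ_k w_k k² Q_k(A,Aᶜ)`);
  **`weightedAdjacentScheme_spectralGap_le`** (any `π̃`-reversible adjacent exchange move `Q`, any `w`:
  `Gap ≤ (t/2 + (1−t)Σ_kw_kk²Q_k(A,Aᶜ))/Σ_kk²μ_k(A)μ_k(Aᶜ)`); **`weightedAdjacentSchemeFrozen_spectralGap_le`** (frozen
  cold replicas, `μ_k(A)μ_k(Aᶜ) ≥ v`: `Gap ≤ 3t/(v·K(K+1)(2K+1))` — EVERY `w`).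
* §2 `ptBareSwap_ne_zero` (support of the plain swap), `weightedLadder_swap_flow_ge`;
  **`weightedLadder_spectralGap_ge_of_cooling`** (`Gap(t·Sw + (1−t)Upd_w M) ≥ min{pq^Kt/(6K²(K+1)), pq^Kγ₀(1−t)w_0/(6(K+1))}`,
  arbitrary `μ_k`-reversible cold updates); `weightedLadderIdentical_spectralGap_ge`.
* §3 **`hotOnlyLadder_spectralGap_two_sided`** — identical levels, hot-only updates, sector-frozen cold replicas:
  `min{t/(6K²(K+1)), γ₀(1−t)/(6(K+1))} ≤ Gap ≤ 3t/(v·K(K+1)(2K+1))`.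

Reading (no numerics implied): on a ladder the `K` passive replicas are served by a label that moves one rung per accepted
swap in a direction chosen afresh each time; feeding the hot end faster does not shorten that walk.  NOT CLAIMED: lifted
(non-reversible) swap schedules (`Scaling/SectorCountMixingFloor`, `Scaling/LevelSchemeBallisticFloor` bound those);
anything measured.  Literature grade (cell rule): OWN COROLLARIES of R14/R6b; nothing cited as a fact; no new bib keys.
-/

noncomputable section

open Finset Function
open Literature.Probability.MarkovChains

namespace Summit.Ventures.LatticeQCDFlow.Scaling

variable {S : Type*} [Fintype S] [DecidableEq S] {K : ℕ} {μ : Fin (K + 1) → S → ℝ}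
  {M : Fin (K + 1) → S → S → ℝ} {w : Fin (K + 1) → ℝ} {t : ℝ}

/-! ## §1 The diffusive ceiling for every allocation of the updates -/

/-- **The weighted update's Dirichlet form of the linear count:** `𝓔_π̃(Upd_w; G) = Σ_k w_k·k²·Q_k(A,Aᶜ)`. [ours] -/
theorem weightedUpdate_dirichletForm_linearCount (hμ1 : ∀ k, ∑ u, μ k u = 1) (hM : ∀ k, IsRowStochastic (M k))
    (hMrev : ∀ k, DetailedBalance (μ k) (M k)) (w : Fin (K + 1) → ℝ) (A : Finset S) :
    dirichletForm (tensorFun μ) (prodKernel w M) (fun x => ∑ k : Fin (K + 1), ((k : ℕ) : ℝ) * bottleneckTestFun (μ k) A (x k))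
      = ∑ k : Fin (K + 1), w k * (((k : ℕ) : ℝ) ^ 2 * edgeMeasure (μ k) (M k) A Aᶜ) := by
  rw [dirichletForm_prodKernel_additive μ hμ1 w M (fun k u => ((k : ℕ) : ℝ) * bottleneckTestFun (μ k) A u)]
  refine sum_congr rfl fun k _ => ?_
  rw [dirichletForm_smul, dirichletForm_bottleneckTestFun (hM k) ((hMrev k).isStationary (hM k).2) (hμ1 k) A]

/-- **NO ADJACENT EXCHANGE SCHEME BEATS DIFFUSION, FOR ANY ALLOCATION OF THE UPDATES:** `Q` any row-stochastic
`π̃`-reversible adjacent exchange move, `w` any probability vector, `0 ≤ t ≤ 1`, `|S| ≥ 2`, `Σ_kk²μ_k(A)μ_k(Aᶜ) > 0`: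
`Gap(tQ + (1−t)Upd_w) ≤ (t/2 + (1−t)Σ_kw_kk²Q_k(A,Aᶜ))/Σ_kk²μ_k(A)μ_k(Aᶜ)`. [ours] -/
theorem weightedAdjacentScheme_spectralGap_le [Nontrivial S] (hμ : ∀ k x, 0 < μ k x) (hμ1 : ∀ k, ∑ u, μ k u = 1)
    (hM : ∀ k, IsRowStochastic (M k)) (hMrev : ∀ k, DetailedBalance (μ k) (M k)) (hw0 : ∀ k, 0 ≤ w k)
    (hw1 : ∑ k, w k = 1) (ht0 : 0 ≤ t) (ht1 : t ≤ 1) {Q : Matrix (Fin (K + 1) → S) (Fin (K + 1) → S) ℝ}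
    (hQ : IsRowStochastic Q) (hQrev : DetailedBalance (tensorFun μ) Q) {A : Finset S}
    (hQadj : ∀ x y, Q x y ≠ 0 → y ≠ x → ∃ j : Fin K, ∀ k, (y k ∈ A ↔ x (levelSwap j k) ∈ A))
    (hA : 0 < ∑ k : Fin (K + 1), ((k : ℕ) : ℝ) ^ 2 * ((∑ u ∈ A, μ k u) * ∑ u ∈ Aᶜ, μ k u)) :
    spectralGap (tensorFun μ) (fun x y => t * Q x y + (1 - t) * prodKernel w M x y)
      ≤ (t / 2 + (1 - t) * ∑ k : Fin (K + 1), w k * (((k : ℕ) : ℝ) ^ 2 * edgeMeasure (μ k) (M k) A Aᶜ))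
          / ∑ k : Fin (K + 1), ((k : ℕ) : ℝ) ^ 2 * ((∑ u ∈ A, μ k u) * ∑ u ∈ Aᶜ, μ k u) := by
  have hP := weightedScheme_isRowStochastic hQ hM hw0 hw1 ht0 ht1
  have hDB := weightedScheme_detailedBalance (w := w) hQrev hMrev t
  have hray := LevinPeres2017_lemma_13_7_rayleigh (tensorFun_pos hμ) (sum_tensorFun_eq_one μ hμ1) hP hDB
    (linearCount_mean (μ := μ) hμ1 A)
  rw [linearCount_piInner hμ1, weightedScheme_dirichletForm, weightedUpdate_dirichletForm_linearCount hμ1 hM hMrev w A]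
    at hray
  have hsw := adjacent_dirichletForm_linearCount_le (μ := μ) (fun k u => (hμ k u).le) hμ1 hQ A hQadj
  rw [le_div_iff₀ hA]
  have h1t : 0 ≤ 1 - t := by linarith
  calc spectralGap (tensorFun μ) (fun x y => t * Q x y + (1 - t) * prodKernel w M x y)
        * ∑ k : Fin (K + 1), ((k : ℕ) : ℝ) ^ 2 * ((∑ u ∈ A, μ k u) * ∑ u ∈ Aᶜ, μ k u)
      ≤ t * dirichletForm (tensorFun μ) Q (fun x => ∑ k : Fin (K + 1), ((k : ℕ) : ℝ) * bottleneckTestFun (μ k) A (x k))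
        + (1 - t) * ∑ k : Fin (K + 1), w k * (((k : ℕ) : ℝ) ^ 2 * edgeMeasure (μ k) (M k) A Aᶜ) := hray
    _ ≤ t / 2 + (1 - t) * ∑ k : Fin (K + 1), w k * (((k : ℕ) : ℝ) ^ 2 * edgeMeasure (μ k) (M k) A Aᶜ) := by
        have := mul_le_mul_of_nonneg_left hsw ht0
        linarith

/-- **`Gap ≤ 3t/(v·K(K+1)(2K+1))` FOR EVERY ALLOCATION `w`** over sector-frozen cold replicas (`Q_k(A,Aᶜ) = 0` and
`μ_k(A)μ_k(Aᶜ) ≥ v > 0` for `k ≥ 1`; `K ≥ 1`, `0 ≤ t ≤ 1`, `|S| ≥ 2`), any adjacent exchange move. [ours] -/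
theorem weightedAdjacentSchemeFrozen_spectralGap_le [Nontrivial S] (hK : 1 ≤ K) (hμ : ∀ k x, 0 < μ k x)
    (hμ1 : ∀ k, ∑ u, μ k u = 1) (hM : ∀ k, IsRowStochastic (M k)) (hMrev : ∀ k, DetailedBalance (μ k) (M k))
    (hw0 : ∀ k, 0 ≤ w k) (hw1 : ∑ k, w k = 1) (ht0 : 0 ≤ t) (ht1 : t ≤ 1)
    {Q : Matrix (Fin (K + 1) → S) (Fin (K + 1) → S) ℝ} (hQ : IsRowStochastic Q) (hQrev : DetailedBalance (tensorFun μ) Q)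
    {A : Finset S} (hQadj : ∀ x y, Q x y ≠ 0 → y ≠ x → ∃ j : Fin K, ∀ k, (y k ∈ A ↔ x (levelSwap j k) ∈ A))
    {v : ℝ} (hvpos : 0 < v) (hv : ∀ k : Fin (K + 1), k ≠ 0 → v ≤ (∑ u ∈ A, μ k u) * ∑ u ∈ Aᶜ, μ k u)
    (hfrozen : ∀ k : Fin (K + 1), k ≠ 0 → edgeMeasure (μ k) (M k) A Aᶜ = 0) :
    spectralGap (tensorFun μ) (fun x y => t * Q x y + (1 - t) * prodKernel w M x y)
      ≤ 3 * t / (v * (K * (K + 1) * (2 * K + 1))) := by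
  have hKpos : (0 : ℝ) < K := Nat.cast_pos.mpr (by omega)
  have hVge := linearCount_piInner_ge (μ := μ) hμ1 A hv
  rw [linearCount_piInner hμ1] at hVge
  have hS6 : 0 < v * (K * (K + 1) * (2 * K + 1) / 6) := by positivity
  have hA : 0 < ∑ k : Fin (K + 1), ((k : ℕ) : ℝ) ^ 2 * ((∑ u ∈ A, μ k u) * ∑ u ∈ Aᶜ, μ k u) := lt_of_lt_of_le hS6 hVge
  have h := weightedAdjacentScheme_spectralGap_le (t := t) (M := M) (w := w) hμ hμ1 hM hMrev hw0 hw1 ht0 ht1 hQ hQrev hQadj hA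
  have hU0 : ∑ k : Fin (K + 1), w k * (((k : ℕ) : ℝ) ^ 2 * edgeMeasure (μ k) (M k) A Aᶜ) = 0 := by
    refine Finset.sum_eq_zero fun k _ => ?_
    by_cases hk : k = 0
    · subst hk; simp
    · rw [hfrozen k hk, mul_zero, mul_zero]
  rw [hU0, mul_zero, add_zero] at h
  refine h.trans ?_
  rw [div_le_div_iff₀ hA (by positivity)]
  calc t / 2 * (v * (K * (K + 1) * (2 * K + 1))) = 3 * t * (v * (K * (K + 1) * (2 * K + 1) / 6)) := by ring
    _ ≤ 3 * t * ∑ k : Fin (K + 1), ((k : ℕ) : ℝ) ^ 2 * ((∑ u ∈ A, μ k u) * ∑ u ∈ Aᶜ, μ k u) :=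
        mul_le_mul_of_nonneg_left hVge (by positivity)

/-! ## §2 The weighted plain ladder: the direct conveyor floor -/

/-- **The support of the plain swap:** `Sw(x,y) ≠ 0 ⇒ y = x` or `y = x∘σ_j` for some `j`. [ours] -/
theorem ptBareSwap_ne_zero (hμ : ∀ k x, 0 < μ k x) {x y : Fin (K + 1) → S} (hxy : ptBareSwap μ x y ≠ 0) :
    y = x ∨ ∃ j : Fin K, y = x ∘ levelSwap j := by
  refine or_iff_not_imp_left.mpr fun hyx => ?_
  by_contra hne
  have hT : ptBareProposal x y = 0 := by
    unfold ptBareProposal; exact Finset.sum_eq_zero fun j _ => if_neg fun h => hne ⟨j, h⟩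
  have h := tensorFun_mul_ptBareSwap (μ := μ) hμ hyx
  rw [hT, zero_mul] at h
  exact hxy ((mul_eq_zero.mp h).resolve_left (tensorFun_pos hμ x).ne')

/-- The plain swap is an adjacent exchange move in the sense of `AdjacentSchemeDiffusiveCeiling`. [ours] -/
theorem ptBareSwap_adjacent (hμ : ∀ k x, 0 < μ k x) (A : Finset S) (x y : Fin (K + 1) → S) (hxy : ptBareSwap μ x y ≠ 0)
    (hyx : y ≠ x) : ∃ j : Fin K, ∀ k, (y k ∈ A ↔ x (levelSwap j k) ∈ A) := by
  rcases ptBareSwap_ne_zero hμ hxy with h | ⟨j, hj⟩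
  · exact absurd h hyx
  · exact ⟨j, fun k => by rw [hj]; rfl⟩

/-- **Swap flows of the weighted ladder:** `π̃(x)·P(x, x∘σ_j) ≥ (t/K)·min{π̃(x), π̃(x∘σ_j)}` for `x∘σ_j ≠ x`
(`0 ≤ t ≤ 1`, `w` a probability vector). [ours] -/
theorem weightedLadder_swap_flow_ge (hμ : ∀ k x, 0 < μ k x) (hM : ∀ k, IsRowStochastic (M k)) (hw0 : ∀ k, 0 ≤ w k)
    (hw1 : ∑ k, w k = 1) (ht0 : 0 ≤ t) (ht1 : t ≤ 1) (x : Fin (K + 1) → S) (j : Fin K) (hx : x ∘ levelSwap j ≠ x) :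
    t / K * min (tensorFun μ x) (tensorFun μ (x ∘ levelSwap j))
      ≤ tensorFun μ x * (t * ptBareSwap μ x (x ∘ levelSwap j) + (1 - t) * prodKernel w M x (x ∘ levelSwap j)) := by
  have hU := prodKernel_isRowStochastic M w hw0 hw1 hM
  rw [mul_add, ← mul_assoc, mul_comm (tensorFun μ x) t, mul_assoc, tensorFun_mul_ptBareSwap hμ hx]
  have hT := ptBareProposal_swap_ge j x
  have hmin : 0 ≤ min (tensorFun μ x) (tensorFun μ (x ∘ levelSwap j)) :=
    le_min (tensorFun_pos hμ _).le (tensorFun_pos hμ _).le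
  have hupd : 0 ≤ tensorFun μ x * ((1 - t) * prodKernel w M x (x ∘ levelSwap j)) :=
    mul_nonneg (tensorFun_pos hμ x).le (mul_nonneg (by linarith) (hU.1 _ _))
  calc t / K * min (tensorFun μ x) (tensorFun μ (x ∘ levelSwap j))
      = t * ((1 / K) * min (tensorFun μ x) (tensorFun μ (x ∘ levelSwap j))) := by ring
    _ ≤ t * (ptBareProposal x (x ∘ levelSwap j) * min (tensorFun μ x) (tensorFun μ (x ∘ levelSwap j))) :=
        mul_le_mul_of_nonneg_left (mul_le_mul_of_nonneg_right hT hmin) ht0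
    _ ≤ _ := le_add_of_nonneg_right hupd

/-- **THE DIRECT FLOOR OF THE WEIGHTED LADDER (cooling form):** persistence `p`, one-level cooling `q`, hot Poincaré constant
`γ₀`, update weights `w` with `w_0 > 0`, ARBITRARY `μ_k`-reversible cold updates (`K ≥ 1`, `0 < t < 1`, `|S| ≥ 2`):
`Gap(t·Sw + (1−t)·Upd_w M) ≥ min{pq^Kt/(6K²(K+1)), pq^Kγ₀(1−t)w_0/(6(K+1))}`. [ours] -/
theorem weightedLadder_spectralGap_ge_of_cooling [Nontrivial S] (hK : 1 ≤ K) (hμ : ∀ k x, 0 < μ k x)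
    (hμ1 : ∀ k, ∑ u, μ k u = 1) (hM : ∀ k, IsRowStochastic (M k)) (hMrev : ∀ k, DetailedBalance (μ k) (M k))
    (hw0 : ∀ k, 0 ≤ w k) (hw1 : ∑ k, w k = 1) (hwhot : 0 < w 0) (ht0 : 0 < t) (ht1 : t < 1) {p q γ₀ : ℝ} (hp : 0 < p)
    (hq0 : 0 < q) (hq1 : q ≤ 1) (hγ₀ : 0 < γ₀) (hpers : ∀ (i k : Fin (K + 1)) (u : S), i ≤ k → p * μ k u ≤ μ i u)
    (hq : ∀ (l : Fin K) (u : S), q * μ l.castSucc u ≤ μ l.succ u)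
    (hgap0 : ∀ h : S → ℝ, γ₀ * lawVariance (μ 0) h ≤ dirichletForm (μ 0) (M 0) h) :
    min (p * q ^ K * t / (6 * K ^ 2 * (K + 1))) (p * q ^ K * γ₀ * (1 - t) * w 0 / (6 * (K + 1)))
      ≤ spectralGap (tensorFun μ) (fun x y : Fin (K + 1) → S => t * ptBareSwap μ x y + (1 - t) * prodKernel w M x y) := by
  have hKpos : (0 : ℝ) < K := Nat.cast_pos.mpr (by omega)
  have h1t : 0 < 1 - t := by linarith
  have hpqK : 0 < p * q ^ K := mul_pos hp (pow_pos hq0 K)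
  have hQ := ptBareSwap_isRowStochastic (μ := μ) hμ
  have hP := weightedScheme_isRowStochastic hQ hM hw0 hw1 ht0.le ht1.le
  have hDB := weightedScheme_detailedBalance (w := w) (ptBareSwap_detailedBalance hμ) hMrev t
  set C := min (p * q ^ K * t / (6 * K ^ 2 * (K + 1))) (p * q ^ K * γ₀ * (1 - t) * w 0 / (6 * (K + 1))) with hC
  have hC0 : 0 ≤ C := le_min (by positivity) (by positivity)
  refine le_spectralGap_of_poincare (tensorFun_pos hμ) (sum_tensorFun_eq_one μ hμ1) hP hDB fun f => ?_
  refine conveyor_poincare_of_cooling (ν := μ)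
    (Q := fun x y : Fin (K + 1) → S => t * ptBareSwap μ x y + (1 - t) * prodKernel w M x y)
    (fun k u => (hμ k u).le) hμ1 hp hq0 hq1 (div_pos ht0 hKpos) hγ₀ (mul_pos h1t hwhot) hpers hq hP.1
    (fun z l hz => weightedLadder_swap_flow_ge hμ hM hw0 hw1 ht0.le ht1.le z l hz) hgap0
    (fun z v hv => whub_hot_flow_ge (w := w) hQ.1 hμ ht0.le z hv) f hC0 ?_ ?_
  · calc C * (6 * K * (K + 1)) ≤ p * q ^ K * t / (6 * K ^ 2 * (K + 1)) * (6 * K * (K + 1)) :=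
        mul_le_mul_of_nonneg_right (min_le_left _ _) (by positivity)
      _ = p * q ^ K * (t / K) := by field_simp
  · calc C * (6 * (K + 1)) ≤ p * q ^ K * γ₀ * (1 - t) * w 0 / (6 * (K + 1)) * (6 * (K + 1)) :=
        mul_le_mul_of_nonneg_right (min_le_right _ _) (by positivity)
      _ = p * q ^ K * γ₀ * ((1 - t) * w 0) := by field_simp

/-- **IDENTICAL LEVELS, ANY WEIGHTS:** `Gap ≥ min{t/(6K²(K+1)), γ₀(1−t)w_0/(6(K+1))}`. [ours] -/
theorem weightedLadderIdentical_spectralGap_ge [Nontrivial S] (hK : 1 ≤ K) (hμ : ∀ k x, 0 < μ k x)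
    (hμ1 : ∀ k, ∑ u, μ k u = 1) (hM : ∀ k, IsRowStochastic (M k)) (hMrev : ∀ k, DetailedBalance (μ k) (M k))
    (hw0 : ∀ k, 0 ≤ w k) (hw1 : ∑ k, w k = 1) (hwhot : 0 < w 0) (ht0 : 0 < t) (ht1 : t < 1)
    (hsame : ∀ k, μ k = μ 0) {γ₀ : ℝ} (hγ₀ : 0 < γ₀)
    (hgap0 : ∀ h : S → ℝ, γ₀ * lawVariance (μ 0) h ≤ dirichletForm (μ 0) (M 0) h) :
    min (t / (6 * K ^ 2 * (K + 1))) (γ₀ * (1 - t) * w 0 / (6 * (K + 1)))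
      ≤ spectralGap (tensorFun μ) (fun x y : Fin (K + 1) → S => t * ptBareSwap μ x y + (1 - t) * prodKernel w M x y) := by
  have h := weightedLadder_spectralGap_ge_of_cooling (w := w) (p := 1) (q := 1) hK hμ hμ1 hM hMrev hw0 hw1 hwhot ht0 ht1
    one_pos one_pos le_rfl hγ₀ (fun i k u _ => by rw [hsame k, hsame i, one_mul]) (fun l u => by rw [hsame, hsame l.succ, one_mul])
    hgap0
  simpa using h

/-! ## §3 Hot-only updates: the ladder stays cubic -/

/-- **THE HOT-ONLY LADDER IS `Θ(K³)`:** identical levels, every update spent on the hot replica (`w = 𝟙_{k=0}`), hot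
Poincaré constant `γ₀`, and a sector `A` frozen for the cold updates with `μ_k(A)μ_k(Aᶜ) ≥ v > 0` (`K ≥ 1`, `0 < t < 1`):
`min{t/(6K²(K+1)), γ₀(1−t)/(6(K+1))} ≤ Gap ≤ 3t/(v·K(K+1)(2K+1))`. [ours] -/
theorem hotOnlyLadder_spectralGap_two_sided [Nontrivial S] (hK : 1 ≤ K) (hμ : ∀ k x, 0 < μ k x)
    (hμ1 : ∀ k, ∑ u, μ k u = 1) (hM : ∀ k, IsRowStochastic (M k)) (hMrev : ∀ k, DetailedBalance (μ k) (M k))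
    (ht0 : 0 < t) (ht1 : t < 1) (hsame : ∀ k, μ k = μ 0) {γ₀ : ℝ} (hγ₀ : 0 < γ₀)
    (hgap0 : ∀ h : S → ℝ, γ₀ * lawVariance (μ 0) h ≤ dirichletForm (μ 0) (M 0) h) {A : Finset S} {v : ℝ}
    (hvpos : 0 < v) (hv : ∀ k : Fin (K + 1), k ≠ 0 → v ≤ (∑ u ∈ A, μ k u) * ∑ u ∈ Aᶜ, μ k u)
    (hfrozen : ∀ k : Fin (K + 1), k ≠ 0 → edgeMeasure (μ k) (M k) A Aᶜ = 0) :
    min (t / (6 * K ^ 2 * (K + 1))) (γ₀ * (1 - t) / (6 * (K + 1)))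
        ≤ spectralGap (tensorFun μ) (fun x y : Fin (K + 1) → S =>
            t * ptBareSwap μ x y + (1 - t) * prodKernel (fun k : Fin (K + 1) => if k = 0 then (1 : ℝ) else 0) M x y)
      ∧ spectralGap (tensorFun μ) (fun x y : Fin (K + 1) → S =>
            t * ptBareSwap μ x y + (1 - t) * prodKernel (fun k : Fin (K + 1) => if k = 0 then (1 : ℝ) else 0) M x y)
          ≤ 3 * t / (v * (K * (K + 1) * (2 * K + 1))) := by
  have hw0 : ∀ k : Fin (K + 1), 0 ≤ (if k = 0 then (1 : ℝ) else 0) := fun k => by positivity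
  refine ⟨?_, ?_⟩
  · have h := weightedLadderIdentical_spectralGap_ge (w := fun k : Fin (K + 1) => if k = 0 then (1 : ℝ) else 0) hK hμ hμ1 hM
      hMrev hw0 hotOnlyWeight_sum (by simp) ht0 ht1 hsame hγ₀ hgap0
    simp only [if_true, mul_one] at h
    exact h
  · exact weightedAdjacentSchemeFrozen_spectralGap_le hK hμ hμ1 hM hMrev hw0 hotOnlyWeight_sum ht0.le ht1.le
      (ptBareSwap_isRowStochastic hμ) (ptBareSwap_detailedBalance hμ) (ptBareSwap_adjacent hμ A) hvpos hv hfrozen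

end Summit.Ventures.LatticeQCDFlow.Scaling

end
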